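import Mathlib
import HarnessLib

/-!
# Card H (`decorated-colength-law`), stubs H4a/H4b: the trace of an order-`p` step is `δ^(p-1)`
(crux stmt-ResolutionOfSingularities-15640 `WildQuotients.WildQuotientResolution`, line `Sketch`;
chain w45c R-lane, res-L1-w45c-idea-1's `Sketch-L1-idea-1.lean` v6 §H stubs `stub_geom_sum_eq_sub_one_pow`
(H4a) and `stub_trace_eq_delta_pow` (H4b), named for an idle stub seat by res-L1-w45c-plan-1
2026-08-27T09:38:47Z; [OURS · L1 W4.5c] — NOT a statement of any manuscript; replaces the role of no
printed item. Prover res-L1-w45c-stub-2.)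

* `CardH.geom_sum_X_eq_X_sub_one_pow` — in `𝔽_p[X]`, `1 + X + ⋯ + X^(p-1) = (X - 1)^(p-1)`
  (`geom_sum_mul` + `sub_pow_char`, cancel the non-zero-divisor `X - 1`).
* `CardH.sum_pow_eq_sub_one_pow` — hence for ANY `𝔽_p`-algebra `A` and `a ∈ A` (no hypothesis `a^p = 1`):
  `∑_{i<p} a^i = (a - 1)^(p-1)`; in particular (`CardH.trace_eq_delta_pow`) for an `𝔽_p`-linear
  endomorphism `T` the "trace" `Tr_T = ∑ T^i` is `δ^(p-1)`, `δ = T - 1`: the legality (cocycle)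
  condition `Tr_σ g = 0` of the decorated game reads `δ^(p-1) g = 0`.
-/

-- single-problem summit: the doubled namespace component `ResolutionOfSingularities` is forced
set_option linter.dupNamespace false

noncomputable section

open Polynomial

namespace Summit.ResolutionOfSingularities.ResolutionOfSingularities.Theorems.WildQuotientResolution.CardH

/-- **H4a · trace = δ^(p-1), universal form.** In `𝔽_p[X]`:
`∑_{i<p} X^i = (X - 1)^(p-1)`. [OURS · L1 W4.5c] [folklore] -/
theorem geom_sum_X_eq_X_sub_one_pow (p : ℕ) [Fact p.Prime] :
    (∑ i ∈ Finset.range p, (X : (ZMod p)[X]) ^ i) = (X - 1) ^ (p - 1) := by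
  have hp : p.Prime := Fact.out
  have hX1 : (X - 1 : (ZMod p)[X]) ≠ 0 := by
    rw [← map_one (C : ZMod p →+* (ZMod p)[X])]
    exact X_sub_C_ne_zero 1
  refine mul_right_cancel₀ hX1 ?_
  rw [geom_sum_mul, ← pow_succ, Nat.sub_add_cancel hp.one_lt.le, sub_pow_char, one_pow]

/-- **H4a in any `𝔽_p`-algebra**: `∑_{i<p} a^i = (a - 1)^(p-1)` for every element `a` of a (possibly
non-commutative) `𝔽_p`-algebra — by evaluating the universal identity at `a`. [OURS · L1 W4.5c]
[folklore] -/
theorem sum_pow_eq_sub_one_pow (p : ℕ) [Fact p.Prime] {A : Type*} [Ring A] [Algebra (ZMod p) A]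
    (a : A) : (∑ i ∈ Finset.range p, a ^ i) = (a - 1) ^ (p - 1) := by
  have h := congrArg (Polynomial.aeval a) (geom_sum_X_eq_X_sub_one_pow p)
  simpa only [map_sum, map_pow, map_sub, map_one, Polynomial.aeval_X] using h

/-- **H4b · trace = δ^(p-1) for an `𝔽_p`-linear endomorphism** `T` of an `𝔽_p`-vector space:
`∑_{i<p} T^i = (T - 1)^(p-1)` (no hypothesis `T^p = 1`). [OURS · L1 W4.5c] [folklore] -/
theorem trace_eq_delta_pow (p : ℕ) [Fact p.Prime] {V : Type*} [AddCommGroup V]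
    [Module (ZMod p) V] (T : Module.End (ZMod p) V) :
    (∑ i ∈ Finset.range p, T ^ i) = (T - 1) ^ (p - 1) :=
  sum_pow_eq_sub_one_pow p T

/-- **The legality residue**: if `T^p = 1` on an `𝔽_p`-vector space then `(T - 1)^p = 0`, and the
cocycle condition `∑ T^i v = 0` is `(T - 1)^(p-1) v = 0`. [OURS · L1 W4.5c] [folklore] -/
theorem delta_pow_eq_zero_of_pow_eq_one (p : ℕ) [Fact p.Prime] {A : Type*} [Ring A]
    [Algebra (ZMod p) A] (a : A) (ha : a ^ p = 1) : (a - 1) ^ p = 0 := by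
  have hp : p.Prime := Fact.out
  calc (a - 1) ^ p = (a - 1) ^ (p - 1) * (a - 1) := by
        rw [← pow_succ, Nat.sub_add_cancel hp.one_lt.le]
    _ = (∑ i ∈ Finset.range p, a ^ i) * (a - 1) := by rw [sum_pow_eq_sub_one_pow]
    _ = 0 := by rw [geom_sum_mul, ha, sub_self]

end Summit.ResolutionOfSingularities.ResolutionOfSingularities.Theorems.WildQuotientResolution.CardH

end
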